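import Summits.FinalStateConjecture.FinalStateConjecture.Theorems.EIHFluxBalanceModulatedKerrHandoffBentLabDeviationAux2
import Mathlib.Analysis.Calculus.ContDiff.Bounds
import HarnessLib

set_option linter.dupNamespace false

/-!
# Stub `stub_bentShiftBounds` (T3a) of line `swallow-transfer`, crux `EIHFluxBalance.ModulatedKerrHandoff` (stmt-FinalStateConjecture-10167)

Support file for crux `stmt-FinalStateConjecture-10167`
(`Summit.FinalStateConjecture.FinalStateConjecture.Theses.EIHFluxBalance.ModulatedKerrHandoff`), line
`swallow-transfer`: the registered stub `stub_bentShiftBounds` (statement VERBATIM from the registered skeleton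
`Cruxes/ModulatedKerrHandoff/Lines/swallow_transfer.lean`).

**The bent shift.** `Θ(x) = χ₁(|x̲|/x⁰ − 1) · T(|x̲|)` (`χ₁ = Real.smoothTransition`, `T = bentHeight M a`,
`|x̲| = E4.spatialNorm x`) is the product of the CUTOFF `p(x) = χ₁(|x̲|/x⁰ − 1)` (smooth on the half-space
`{x⁰ > 0}`, `≡ 0` on `{|x̲| < x⁰}`, `≡ 1` on `{|x̲| > 2x⁰}`, `‖Dⁱp(x)‖ ≤ A/(x⁰)ⁱ`:
`BentLabDeviation.bentLabDeviation_cutoff_bounds`) and the RADIAL HEIGHT `x ↦ T(|x̲|)` (smooth on `E4`,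
`‖T(|x̲|)‖ ≤ 2M log(L/M)` for `M ≤ |x̲| ≤ L`, `‖Dʲ T(|x̲|)‖ ≤ B/|x̲|` for `1 ≤ j ≤ 4`, `|x̲| ≥ R₁`,
`0 ≤ x⁰ ≤ |x̲|`: `BentLabDeviation.bentLabDeviation_radialHeight_decay`). This file proves:

* `Θ` is `C^∞` on `{x⁰ > 0}`;
* on the late lab slabs `x⁰ = t ≥ τ₁ := max R₁ (max M 1)` the derivatives of orders `1 ≤ i ≤ 4` obey
  `‖DⁱΘ(x)‖ ≤ ε(t) := 16 A (B + 2M log(2t/M)) / t → 0`: inside the cone `|x̲| < t` the shift vanishes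
  near `x`; beyond `|x̲| > 2t` it is the radial height near `x` (bound `B/|x̲| ≤ B/t`); in the shell
  `t ≤ |x̲| ≤ 2t` the Leibniz rule (`norm_iteratedFDerivWithin_mul_le`) bounds every term of `Dⁱ(p · T)` by
  `(i choose k) · A (B + 2M log(2t/M)) / t`, and `∑ₖ (i choose k) = 2ⁱ ≤ 16`.

References: elementary calculus (Leibniz rule, `log t / t → 0`). [folklore]
-/

noncomputable section

open scoped ContDiff Topology
open Set Filter Topology Literature.Geometry.Lorentzian
open Summit.FinalStateConjecture.FinalStateConjecture.Theorems.KerrShieldedDataExist.Negative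
  (bentHeight mass_pos)
open Summit.FinalStateConjecture.FinalStateConjecture.Theorems.BentLabDeviation
  (contDiffAt_cutoff contDiff_radialHeight continuous_apply_zero cutoff_eventuallyEq_one
    cutoff_eventuallyEq_zero norm_cutoff_le_one bentLabDeviation_cutoff_bounds norm_radialHeight_le_of_le
    bentLabDeviation_radialHeight_decay)

namespace Summit.FinalStateConjecture.FinalStateConjecture.Cruxes.ModulatedKerrHandoff.SwallowTransfer

section BentShift

variable {M a : ℝ}

/-! ## Smoothness of the shift on the half-space `{x⁰ > 0}` -/

/-- The shift `Θ = p · T` is `C^∞` on the open half-space `{x⁰ > 0}` (the cutoff is smooth there, the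
radial height everywhere). [folklore] -/
theorem contDiffOn_bentShift_halfSpace (h : |a| < M) :
    ContDiffOn ℝ ∞ (fun x : E4 ↦ Real.smoothTransition (E4.spatialNorm x / x 0 - 1) *
      bentHeight M a (E4.spatialNorm x)) {x : E4 | 0 < x 0} := fun _ hy ↦
  ((contDiffAt_cutoff hy).mul (contDiff_radialHeight h).contDiffAt).contDiffWithinAt

/-! ## The decay rate `ε(t) = K (B + 2M log(2t/M)) / t` -/

/-- `log(2t/M) / t → 0` as `t → ∞` (`M > 0`): the substitution `s = 2t/M` in `log s / ((M/2) s) → 0`.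
[folklore] -/
private theorem tendsto_log_two_mul_div_div (hM : 0 < M) :
    Tendsto (fun t : ℝ ↦ Real.log (2 * t / M) / t) atTop (𝓝 0) := by
  have h1 := Real.tendsto_pow_log_div_mul_add_atTop (M / 2) 0 1 (by positivity)
  have h2 : Tendsto (fun t : ℝ ↦ 2 * t / M) atTop atTop :=
    (tendsto_id.const_mul_atTop two_pos).atTop_div_const hM
  refine (h1.comp h2).congr fun t ↦ ?_
  simp only [Function.comp_apply, pow_one, add_zero]
  congr 1
  field_simp

/-- The rate `K (B + 2M log(2t/M)) / t` tends to `0` at `∞`. [folklore] -/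
private theorem tendsto_bentShiftRate (hM : 0 < M) (K B : ℝ) :
    Tendsto (fun t : ℝ ↦ K * (B + 2 * M * Real.log (2 * t / M)) / t) atTop (𝓝 0) := by
  have h1 : Tendsto (fun t : ℝ ↦ t⁻¹) atTop (𝓝 0) := tendsto_inv_atTop_zero
  have h := (h1.const_mul (K * B)).add ((tendsto_log_two_mul_div_div hM).const_mul (2 * K * M))
  rw [mul_zero, mul_zero, add_zero] at h
  refine h.congr fun t ↦ ?_
  ring

/-! ## The pointwise bounds on a late slab -/

/-- **Shell estimate.** In the shell `x⁰ ≤ |x̲| ≤ 2x⁰` of a late slab (`x⁰ ≥ max R₁ (max M 1)`) the Leibniz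
rule bounds `‖Dⁱ(p · T)(x)‖`, `1 ≤ i ≤ 4`, by `16 A (B + 2M log(2x⁰/M)) / x⁰`: every term
`(i choose k) ‖Dᵏp‖ ‖Dⁱ⁻ᵏT‖` has `k ≥ 1` (then `‖Dᵏp‖ ≤ A/(x⁰)ᵏ ≤ A/x⁰` and `‖Dⁱ⁻ᵏT‖ ≤ B` or
`≤ 2M log(2x⁰/M)`) or `k = 0` (then `‖p‖ ≤ 1 ≤ A`, `‖DⁱT‖ ≤ B/x⁰`). [folklore] -/
private theorem norm_iteratedFDeriv_bentShift_le_shell (h : |a| < M) {A B R₁ : ℝ} (hA1 : 1 ≤ A)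
    (hA : ∀ i ≤ 4, ∀ y : E4, 0 < y 0 →
      ‖iteratedFDeriv ℝ i (fun z : E4 ↦ Real.smoothTransition (E4.spatialNorm z / z 0 - 1)) y‖ ≤
        A / y 0 ^ i)
    (hB0 : 0 ≤ B)
    (hB : ∀ j : ℕ, 1 ≤ j → j ≤ 4 → ∀ y : E4, R₁ ≤ E4.spatialNorm y → 0 ≤ y 0 →
      y 0 ≤ E4.spatialNorm y →
        ‖iteratedFDeriv ℝ j (fun z : E4 ↦ bentHeight M a (E4.spatialNorm z)) y‖ ≤ B / E4.spatialNorm y)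
    {x : E4} (hR : R₁ ≤ x 0) (hMx : M ≤ x 0) (h1 : 1 ≤ x 0) (hin : x 0 ≤ E4.spatialNorm x)
    (hout : E4.spatialNorm x ≤ 2 * x 0) {i : ℕ} (hi1 : 1 ≤ i) (hi4 : i ≤ 4) :
    ‖iteratedFDeriv ℝ i (fun z : E4 ↦ Real.smoothTransition (E4.spatialNorm z / z 0 - 1) *
        bentHeight M a (E4.spatialNorm z)) x‖ ≤
      16 * A * (B + 2 * M * Real.log (2 * x 0 / M)) / x 0 := by
  set p : E4 → ℝ := fun z ↦ Real.smoothTransition (E4.spatialNorm z / z 0 - 1) with hp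
  set T : E4 → ℝ := fun z ↦ bentHeight M a (E4.spatialNorm z) with hT
  set V : Set E4 := {z | 0 < z 0} with hV
  set L : ℝ := 2 * M * Real.log (2 * x 0 / M) with hL
  have hM := mass_pos h
  have ht0 : 0 < x 0 := one_pos.trans_le h1
  have hA0 : 0 ≤ A := zero_le_one.trans hA1
  have hL0 : 0 ≤ L := by
    have : 1 ≤ 2 * x 0 / M := by
      rw [le_div_iff₀ hM]
      linarith
    have := Real.log_nonneg this
    positivity
  have hVo : IsOpen V := isOpen_lt continuous_const continuous_apply_zero
  have hxV : x ∈ V := ht0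
  have hpV : ContDiffOn ℝ ∞ p V := fun z hz ↦ (contDiffAt_cutoff hz).contDiffWithinAt
  have hTV : ContDiffOn ℝ ∞ T V := (contDiff_radialHeight h).contDiffOn
  -- the factor bounds at `x`
  have hpk : ∀ k, 1 ≤ k → k ≤ i → ‖iteratedFDeriv ℝ k p x‖ ≤ A / x 0 := by
    intro k hk1 hki
    refine (hA k (by omega) x ht0).trans (div_le_div_of_nonneg_left hA0 ht0 ?_)
    calc x 0 = x 0 ^ 1 := (pow_one _).symm
      _ ≤ x 0 ^ k := pow_le_pow_right₀ h1 hk1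
  have hTj : ∀ j, 1 ≤ j → j ≤ i → ‖iteratedFDeriv ℝ j T x‖ ≤ B / x 0 := by
    intro j hj1 hji
    exact (hB j hj1 (by omega) x (hR.trans hin) ht0.le hin).trans
      (div_le_div_of_nonneg_left hB0 ht0 hin)
  have hT0 : ‖T x‖ ≤ L := norm_radialHeight_le_of_le h (hMx.trans hin) hout
  -- each Leibniz term
  have hterm : ∀ k ∈ Finset.range (i + 1),
      (i.choose k : ℝ) * ‖iteratedFDerivWithin ℝ k p V x‖ *
          ‖iteratedFDerivWithin ℝ (i - k) T V x‖ ≤ (i.choose k : ℝ) * (A * (B + L) / x 0) := by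
    intro k hk
    have hki : k ≤ i := Nat.lt_succ_iff.mp (Finset.mem_range.mp hk)
    rw [iteratedFDerivWithin_of_isOpen k hVo hxV, iteratedFDerivWithin_of_isOpen (i - k) hVo hxV,
      mul_assoc]
    refine mul_le_mul_of_nonneg_left ?_ (Nat.cast_nonneg _)
    rcases Nat.eq_zero_or_pos k with rfl | hk1
    · -- `k = 0`: `‖p‖ ≤ 1`, `‖DⁱT‖ ≤ B / x⁰`
      rw [norm_iteratedFDeriv_zero, Nat.sub_zero]
      calc ‖p x‖ * ‖iteratedFDeriv ℝ i T x‖ ≤ 1 * (B / x 0) :=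
            mul_le_mul (norm_cutoff_le_one x) (hTj i hi1 le_rfl) (norm_nonneg _) zero_le_one
        _ ≤ A * (B + L) / x 0 := by
            rw [one_mul, mul_div_assoc]
            calc B / x 0 = 1 * (B / x 0) := (one_mul _).symm
              _ ≤ A * ((B + L) / x 0) := mul_le_mul hA1
                  (div_le_div_of_nonneg_right (by linarith) ht0.le) (by positivity) hA0
    · rcases Nat.eq_zero_or_pos (i - k) with hik | hik
      · -- `k = i`: `‖Dⁱp‖ ≤ A / x⁰`, `‖T‖ ≤ L`
        rw [hik, norm_iteratedFDeriv_zero]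
        calc ‖iteratedFDeriv ℝ k p x‖ * ‖T x‖ ≤ A / x 0 * L :=
              mul_le_mul (hpk k hk1 hki) hT0 (norm_nonneg _) (by positivity)
          _ ≤ A * (B + L) / x 0 := by
              rw [div_mul_eq_mul_div]
              exact div_le_div_of_nonneg_right (by nlinarith) ht0.le
      · -- `1 ≤ k`, `1 ≤ i - k`: `(A / x⁰) (B / x⁰) ≤ A B / x⁰`
        calc ‖iteratedFDeriv ℝ k p x‖ * ‖iteratedFDeriv ℝ (i - k) T x‖ ≤ A / x 0 * (B / x 0) :=
              mul_le_mul (hpk k hk1 hki) (hTj (i - k) hik (Nat.sub_le i k)) (norm_nonneg _)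
                (by positivity)
          _ ≤ A / x 0 * B := mul_le_mul_of_nonneg_left (div_le_self hB0 h1) (by positivity)
          _ ≤ A * (B + L) / x 0 := by
              rw [div_mul_eq_mul_div]
              exact div_le_div_of_nonneg_right (by nlinarith) ht0.le
  -- Leibniz
  rw [← iteratedFDerivWithin_of_isOpen i hVo hxV]
  have hLeib := norm_iteratedFDerivWithin_mul_le (n := i) hpV hTV hVo.uniqueDiffOn hxV
    (by exact_mod_cast le_top)
  refine hLeib.trans ((Finset.sum_le_sum hterm).trans ?_)
  rw [← Finset.sum_mul]
  have hchoose : ∑ k ∈ Finset.range (i + 1), (i.choose k : ℝ) = 2 ^ i := by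
    exact_mod_cast Nat.sum_range_choose i
  rw [hchoose]
  have h2i : (2 : ℝ) ^ i ≤ 16 :=
    calc (2 : ℝ) ^ i ≤ 2 ^ 4 := pow_le_pow_right₀ one_le_two hi4
      _ = 16 := by norm_num
  calc 2 ^ i * (A * (B + L) / x 0) ≤ 16 * (A * (B + L) / x 0) :=
        mul_le_mul_of_nonneg_right h2i (by positivity)
    _ = 16 * A * (B + L) / x 0 := by ring

/-- **Slab estimate.** On a late slab `x⁰ = t ≥ max R₁ (max M 1)`, `‖Dⁱ(p · T)(x)‖ ≤ 16 A (B + 2M log(2t/M)) / t`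
for `1 ≤ i ≤ 4`: inside the cone `|x̲| < t` the shift vanishes near `x`, beyond `|x̲| > 2t` it equals the
radial height near `x` (`‖DⁱT‖ ≤ B/|x̲| ≤ B/t`), and in the shell the shell estimate applies. [folklore] -/
private theorem norm_iteratedFDeriv_bentShift_le_slab (h : |a| < M) {A B R₁ : ℝ} (hA1 : 1 ≤ A)
    (hA : ∀ i ≤ 4, ∀ y : E4, 0 < y 0 →
      ‖iteratedFDeriv ℝ i (fun z : E4 ↦ Real.smoothTransition (E4.spatialNorm z / z 0 - 1)) y‖ ≤
        A / y 0 ^ i)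
    (hB0 : 0 ≤ B)
    (hB : ∀ j : ℕ, 1 ≤ j → j ≤ 4 → ∀ y : E4, R₁ ≤ E4.spatialNorm y → 0 ≤ y 0 →
      y 0 ≤ E4.spatialNorm y →
        ‖iteratedFDeriv ℝ j (fun z : E4 ↦ bentHeight M a (E4.spatialNorm z)) y‖ ≤ B / E4.spatialNorm y)
    {x : E4} (hR : R₁ ≤ x 0) (hMx : M ≤ x 0) (h1 : 1 ≤ x 0) {i : ℕ} (hi1 : 1 ≤ i) (hi4 : i ≤ 4) :
    ‖iteratedFDeriv ℝ i (fun z : E4 ↦ Real.smoothTransition (E4.spatialNorm z / z 0 - 1) *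
        bentHeight M a (E4.spatialNorm z)) x‖ ≤
      16 * A * (B + 2 * M * Real.log (2 * x 0 / M)) / x 0 := by
  set T : E4 → ℝ := fun z ↦ bentHeight M a (E4.spatialNorm z) with hT
  set L : ℝ := 2 * M * Real.log (2 * x 0 / M) with hL
  have hM := mass_pos h
  have ht0 : 0 < x 0 := one_pos.trans_le h1
  have hA0 : 0 ≤ A := zero_le_one.trans hA1
  have hL0 : 0 ≤ L := by
    have : 1 ≤ 2 * x 0 / M := by
      rw [le_div_iff₀ hM]
      linarith
    have := Real.log_nonneg this
    positivity
  have hε0 : 0 ≤ 16 * A * (B + L) / x 0 := by positivity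
  have hBε : B / x 0 ≤ 16 * A * (B + L) / x 0 := by
    refine div_le_div_of_nonneg_right ?_ ht0.le
    nlinarith
  rcases lt_or_ge (E4.spatialNorm x) (x 0) with hin | hin
  · -- inside the cone: `Θ ≡ 0` near `x`
    have hev : (fun z : E4 ↦ Real.smoothTransition (E4.spatialNorm z / z 0 - 1) *
        bentHeight M a (E4.spatialNorm z)) =ᶠ[𝓝 x] fun _ ↦ (0 : ℝ) := by
      filter_upwards [cutoff_eventuallyEq_zero ht0 hin] with z hz
      rw [hz, zero_mul]
    rw [(hev.iteratedFDeriv ℝ i).eq_of_nhds, iteratedFDeriv_const_of_ne (by omega)]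
    simpa using hε0
  rcases lt_or_ge (2 * x 0) (E4.spatialNorm x) with hfar | hout
  · -- beyond `2x⁰`: `Θ = T(|x̲|)` near `x`
    have hev : (fun z : E4 ↦ Real.smoothTransition (E4.spatialNorm z / z 0 - 1) *
        bentHeight M a (E4.spatialNorm z)) =ᶠ[𝓝 x] T := by
      filter_upwards [cutoff_eventuallyEq_one ht0 hfar] with z hz
      rw [hz, one_mul]
    rw [(hev.iteratedFDeriv ℝ i).eq_of_nhds]
    calc ‖iteratedFDeriv ℝ i T x‖ ≤ B / E4.spatialNorm x := hB i hi1 hi4 x (hR.trans hin) ht0.le hin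
      _ ≤ B / x 0 := div_le_div_of_nonneg_left hB0 ht0 hin
      _ ≤ 16 * A * (B + L) / x 0 := hBε
  · exact norm_iteratedFDeriv_bentShift_le_shell h hA1 hA hB0 hB hR hMx h1 hin hout hi1 hi4

end BentShift

/-- **T3a `stub_bentShiftBounds`.** The bent shift `Θ(x) = χ₁(|x̲|/x⁰ − 1) · T(|x̲|)` is `C^∞` on `{x⁰ > 0}`
(`contDiffOn_bentShift_halfSpace`), and its derivatives of orders `1 ≤ i ≤ 4` are uniformly small on late lab
slabs: with `A` from `BentLabDeviation.bentLabDeviation_cutoff_bounds` and `B, R₁` from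
`BentLabDeviation.bentLabDeviation_radialHeight_decay`, `τ₁ := max R₁ (max M 1)` and
`ε(t) := 16 A (B + 2M log(2t/M)) / t → 0` (`tendsto_bentShiftRate`), one has `‖DⁱΘ(x)‖ ≤ ε(x⁰)` for
`x⁰ ≥ τ₁` (`norm_iteratedFDeriv_bentShift_le_slab`: cone / shell / far zone, Leibniz in the shell). [folklore] -/
theorem stub_bentShiftBounds : ∀ (M a : ℝ), |a| < M →
    ContDiffOn ℝ ((⊤ : ℕ∞) : WithTop ℕ∞)
      (fun x : E4 ↦ Real.smoothTransition (E4.spatialNorm x / x 0 - 1) *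
            bentHeight M a (E4.spatialNorm x))
      {x : E4 | 0 < x 0} ∧
    ∃ (τ₁ : ℝ) (ε : ℝ → ℝ), 0 < τ₁ ∧ Tendsto ε atTop (𝓝 0) ∧
      ∀ x : E4, τ₁ ≤ x 0 → ∀ i : ℕ, 1 ≤ i → i ≤ 4 →
        ‖iteratedFDeriv ℝ i
          (fun x : E4 ↦ Real.smoothTransition (E4.spatialNorm x / x 0 - 1) *
            bentHeight M a (E4.spatialNorm x)) x‖ ≤ ε (x 0) := by
  intro M a h
  have hM := mass_pos h
  refine ⟨contDiffOn_bentShift_halfSpace h, ?_⟩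
  obtain ⟨A, hA1, hA⟩ := bentLabDeviation_cutoff_bounds
  obtain ⟨B, R₁, hB0, hR₁, hB⟩ := bentLabDeviation_radialHeight_decay h
  refine ⟨max R₁ (max M 1), fun t ↦ 16 * A * (B + 2 * M * Real.log (2 * t / M)) / t,
    lt_max_of_lt_left hR₁, tendsto_bentShiftRate hM (16 * A) B, fun x hx i hi1 hi4 ↦ ?_⟩
  have hR : R₁ ≤ x 0 := (le_max_left _ _).trans hx
  have hMx : M ≤ x 0 := ((le_max_left _ _).trans (le_max_right _ _)).trans hx
  have h1 : 1 ≤ x 0 := ((le_max_right _ _).trans (le_max_right _ _)).trans hx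
  exact norm_iteratedFDeriv_bentShift_le_slab h hA1 hA hB0 hB hR hMx h1 hi1 hi4

end Summit.FinalStateConjecture.FinalStateConjecture.Cruxes.ModulatedKerrHandoff.SwallowTransfer

end
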